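import Summits.BirchSwinnertonDyer.Rank1Residual.ManinAdditive.DegeneracyClassEulerUnitTwist
import Summits.BirchSwinnertonDyer.Rank1Residual.ManinAdditive.TowerUnitTwist
import HarnessLib
import HarnessLib.Audit.Tags

/-!
# THEOREM U♮E₁ (es g22, PROVED): ONE sharp prime — Euler-translated prime-class degeneracy loops of plus index prime to
# `3` give a unit twist with its Euler factor; h66 at the `k = 1` levels from the law E-es-92 (cell `bsd-f2-manin`,
# T-es-29 (h), typer g15)

Cell `bsd-f2-manin` (D-0131 (3) frontier), lens es, planner es g22 MEMO-es §36.14 («PROVED (3)» 2026-08-28T20:38:09Z); landed by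
the cell typer g15 VERBATIM from HOME/es/Sketch-es-g22-thm87.lean sha16 1fa952104aa82908: the remainder of §E (file lines 1119–1151
`sum_char_inv_mul_euler_twistedSymbolSum` = ORTHOGONALITY WITH THE EULER FACTOR «`Σ_χ χ(x⁻¹)·E_l(χ)·S_χ = φ(ℓ)·[(l²+a²)·V(x) −
a l·(V(x l̄⁻¹) + V(x l̄))]`», 1168–1178 `degLoop_add_conj`, 1207–1345 **THEOREM U♮E₁** `exists_prime_eulerUnitTwist_of_degeneracyClass`:
the E-translated prime-class loops of ratio `t` for ONE sharp prime `l` with coefficient `a` (tree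
`KatoCurve.degeneracyLoopsClassTwoEuler`, leaf `DegeneracyClassEulerLaws`) of plus index prime to `3` ⟹ a prime `ℓ ≡ 2 (mod 3)`,
`ℓ ∤ tN`, `ℓ ∤ l`, an even primitive `χ ≠ 1` with `3 ∤ ord χ`, `χ(t̄) ≠ 1`, `E_l(χ)·S_χ = r·Ω⁺_f`, `s·r/3 ∉ ℤ̄`) and §WLevelEuler (lines
1364–1419: **THEOREM U9♮E₁** `threeAdicPolarWitness_of_degeneracyClassNineEuler` at levels with EXACTLY ONE sharp prime
`(N.primeFactors.filter (¬ ·² ∣ N)) = {l}`, its `3 ∤ c(W)` corollary modulo `KatoFactThreeAt`, and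
`threeAdicPolarWitness_of_eulerLawNine` = h66 with additivity binders at the `k = 1` levels from the law E-es-92
`KatoCurve.DegeneracyClassEulerLawNine`).  Namespace `BsdF2ManinEsG22T` ↦ `…ManinAdditive.KatoCurve`.  TYPER EDGE (PROVED): the
additivity-free form `threeAdicPolarWitness_of_eulerLawNine'` (additivity at `3` from `9 ∣ N`, `additive_of_sq_dvd_level 3`).
RELATION TO THE LIST VERSION (`DegeneracyClassEulerUnitTwist` / `…Witnesses`, THEOREM U♮E_L and E-es-93): same conclusion from
a formally DIFFERENT hypothesis (`DegeneracyClassEulerPlusIndexPrimeTo f 3 t l a`, 4-tuple generators `(m, b, bp, bm)`, vs the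
weight-function generators of `DegeneracyClassEulerListPlusIndexPrimeTo … [l] …`); es states E-es-93 ⟹ E-es-92 on paper — no
formal edge between the two hypotheses is landed (it needs the cusp-value bookkeeping `degLoop ↔ Σ_x θ_l(w_b)(x)·V(x)`).

EVERYTHING HERE IS A SORRY-FREE THEOREM modulo named hypotheses.  HABITAT (es): `k = 1` sharp prime: 1534 classes `9 ∣ N ≤ 5000`
(E43: conclusion certified 1532/1534; census D-es-30 REQUESTED).  REF1 §R91 (R-es-43/44 ANSWERED 2026-08-28T21:14:26Z,
HOME/ref1/R91-ref1-es-g22.md 800686d5a3b62d5b): THEOREM U♮E₁ CONFIRMED (PH99 rc 0, axioms standard), E-es-92 SURVIVES as a law,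
BC7 CLEAN.  bears_on: stmt-BirchSwinnertonDyer-22968 (TURNKEY-es-17: h66 at k = 1 levels := E-es-92 + `threeAdicPolarWitness_of_eulerLawNine`).
PARTITION (es): k = 1 locus 1534/4313 · beyond-print theorem: es says YES (lemma-level) · BSD is not proved by this; Manin's
conjecture is not proved by this.
-/

noncomputable section

open scoped Classical MatrixGroups ModularForm ComplexConjugate

open CongruenceSubgroup Complex Literature.NumberTheory.EllipticCurves
  Literature.NumberTheory.EllipticCurves.ModularForms
open Summit.BirchSwinnertonDyer.Rank1Residual.ManinAdditive.KatoCurve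
open Summit.BirchSwinnertonDyer.Rank1Residual.ManinAdditive.Gamma1Lattice

namespace Summit.BirchSwinnertonDyer.Rank1Residual.ManinAdditive.KatoCurve

section EulerClassOnePrime

variable {N : ℕ} (f : CuspForm (Gamma0 N) 2)

/-- ORTHOGONALITY WITH THE EULER FACTOR: `Σ_χ χ(x⁻¹)·E_l(χ)·S_χ = φ(ℓ)·[(l²+a²)·V(x) − a l·(V(x l̄⁻¹) + V(x l̄))]`. -/
theorem sum_char_inv_mul_euler_twistedSymbolSum [NeZero N] {ℓ : ℕ} [Fact ℓ.Prime] [NeZero ℓ] (l : ℕ) (a : ℤ)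
    {x y z : ZMod ℓ} (hx : x ≠ 0) (hl : (l : ZMod ℓ) ≠ 0) (hy : y = x * (l : ZMod ℓ)⁻¹)
    (hz : z = x * (l : ZMod ℓ)) :
    ∑ χ : DirichletCharacter ℂ ℓ, χ x⁻¹ * (eulerFactorTwist l a χ * twistedSymbolSum f χ)
      = (ℓ.totient : ℂ) * ((((l : ℤ) ^ 2 + a ^ 2 : ℤ) : ℂ) * cuspValue f ℓ x
          - ((a * l : ℤ) : ℂ) * (cuspValue f ℓ y + cuspValue f ℓ z)) := by
  subst hy hz
  have hxu : IsUnit x := isUnit_iff_ne_zero.mpr hx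
  have hx1 : IsUnit (x * (l : ZMod ℓ)⁻¹) := isUnit_iff_ne_zero.mpr (mul_ne_zero hx (inv_ne_zero hl))
  have hx2 : IsUnit (x * (l : ZMod ℓ)) := isUnit_iff_ne_zero.mpr (mul_ne_zero hx hl)
  have key : ∀ χ : DirichletCharacter ℂ ℓ,
      χ x⁻¹ * (eulerFactorTwist l a χ * twistedSymbolSum f χ)
        = (((l : ℤ) ^ 2 + a ^ 2 : ℤ) : ℂ) * (χ x⁻¹ * twistedSymbolSum f χ)
          - ((a * l : ℤ) : ℂ) * (χ (x * (l : ZMod ℓ)⁻¹)⁻¹ * twistedSymbolSum f χ)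
          - ((a * l : ℤ) : ℂ) * (χ (x * (l : ZMod ℓ))⁻¹ * twistedSymbolSum f χ) := by
    intro χ
    have hmul : χ (l : ZMod ℓ) * χ (l : ZMod ℓ)⁻¹ = 1 := by
      rw [← map_mul, mul_inv_cancel₀ hl, map_one]
    have hne : χ (l : ZMod ℓ) ≠ 0 := left_ne_zero_of_mul_eq_one hmul
    have hinv : χ (l : ZMod ℓ)⁻¹ = (χ (l : ZMod ℓ))⁻¹ := eq_inv_of_mul_eq_one_right hmul
    have h1 : χ (x * (l : ZMod ℓ)⁻¹)⁻¹ = χ x⁻¹ * χ (l : ZMod ℓ) := by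
      rw [mul_inv, inv_inv, map_mul]
    have h2 : χ (x * (l : ZMod ℓ))⁻¹ = χ x⁻¹ * (χ (l : ZMod ℓ))⁻¹ := by
      rw [mul_inv, map_mul, hinv]
    rw [h1, h2]
    unfold eulerFactorTwist
    push_cast
    field_simp
    ring
  simp_rw [key, Finset.sum_sub_distrib, ← Finset.mul_sum, sum_char_inv_mul_twistedSymbolSum f hxu,
    sum_char_inv_mul_twistedSymbolSum f hx1, sum_char_inv_mul_twistedSymbolSum f hx2]
  ring

/-- Plus part of a degeneracy loop in cusp values. -/
theorem degLoop_add_conj [NeZero N] (hreal : ∀ n, (cuspCoeff f n).im = 0) (t : ℕ) {m : ℕ} [NeZero m]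
    (b : ℕ) {x : ZMod m} (hx : ((b : ℕ) : ZMod m) = x) :
    degLoop f t m b + conj (degLoop f t m b)
      = cuspValue f m ((t : ZMod m) * x) + cuspValue f m (-((t : ZMod m) * x))
        - cuspValue f m x - cuspValue f m (-x) := by
  have hcast : (t : ZMod m) * x = ((t * b : ℕ) : ZMod m) := by rw [← hx]; push_cast; ring
  rw [hcast, ← hx, cuspValue_neg f hreal, cuspValue_neg f hreal, cuspValue_natCast, cuspValue_natCast]
  unfold degLoop
  rw [map_sub]
  ring

/-- **THEOREM U♮E₁ (f-level, es g22; PROVED).**  If the E-translated prime-class degeneracy loops of ratio `t`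
(multiplicative prime `l`, coefficient `a`) have plus index prime to `3`, there is a prime `ℓ ≡ 2 (mod 3)`,
`ℓ ∤ tN`, `ℓ ∤ l`, an even primitive `χ ≠ 1` mod `ℓ` of order prime to `3` with `χ(t̄) ≠ 1` and
`E_l(χ)·S_χ = r·Ω⁺_f` with `s·r/3 ∉ ℤ̄` for all `s ⊥ 3` — the Euler factor INCLUDED. -/
theorem exists_prime_eulerUnitTwist_of_degeneracyClass [NeZero N] (t l : ℕ) (a : ℤ) (hf : IsNewform0 f)
    (hQ : coeffField f = ⊥) (hd : DegeneracyClassEulerPlusIndexPrimeTo f 3 t l a) :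
    ∃ (ℓ : ℕ) (_ : NeZero ℓ), ℓ.Prime ∧ ℓ % 3 = 2 ∧ ¬ ℓ ∣ t * N ∧ ¬ ℓ ∣ l ∧
      ∃ (χ : DirichletCharacter ℂ ℓ) (r : ℂ),
        ℓ.Coprime (3 * N) ∧ χ.IsPrimitive ∧ χ ≠ 1 ∧ ¬ 3 ∣ orderOf χ ∧ χ (t : ZMod ℓ) ≠ 1 ∧ χ.Even ∧
        eulerFactorTwist l a χ * twistedSymbolSum f χ = r * (plusPeriod f : ℂ) ∧
        ∀ s : ℕ, ¬ 3 ∣ s → ¬ _root_.IsIntegral ℤ ((s : ℂ) * r / 3) := by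
  have hΩpos : 0 < plusPeriod f := IsNewform0.plusPeriod_pos_holds hf hQ
  have hΩ : plusPeriod f ≠ 0 := hΩpos.ne'
  have hΩC : (plusPeriod f : ℂ) ≠ 0 := by exact_mod_cast hΩ
  obtain ⟨hre, -⟩ := realPeriods_eq_zmultiples_of_plusPeriod_ne_zero f hΩ
  have hreal : ∀ n, (cuspCoeff f n).im = 0 := cuspCoeff_im_eq_zero_of_coeffField_eq_bot hQ
  set S : Set ℂ := degeneracyLoopsClassTwoEuler f t l a with hSdef
  have hSΛ : ∀ g ∈ S, g ∈ periodLattice f := fun g hg => degeneracyLoopsClassTwoEuler_subset f t l a hg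
  -- a generator with plus coordinate prime to `3`
  have hgen : ∃ g ∈ S, ∃ j : ℤ, ¬ (3 : ℤ) ∣ j ∧ g + conj g = (j : ℂ) * (plusPeriod f : ℂ) := by
    by_contra hcon
    push Not at hcon
    have hS : ∀ g ∈ S, ∃ k : ℤ, g + conj g = 3 * (k : ℂ) * (plusPeriod f : ℂ) := by
      intro g hg
      obtain ⟨j, hj⟩ := exists_add_conj_eq_int_mul f hre (hSΛ g hg)
      have h3j : (3 : ℤ) ∣ j := by
        by_contra h3
        exact hcon g hg j h3 hj
      obtain ⟨k, rfl⟩ := h3j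
      exact ⟨k, by rw [hj]; push_cast; ring⟩
    obtain ⟨x₀, hx₀, hx₀tr⟩ := exists_mem_add_conj_eq f hre
    obtain ⟨y, hy, k, hk3, hky⟩ := hd x₀ hx₀
    obtain ⟨k', hk'⟩ := add_conj_mem_three_of_closure hS hy
    have hx₀tr' : x₀ + starRingEnd ℂ x₀ = (plusPeriod f : ℂ) := hx₀tr
    have hk'' : y + starRingEnd ℂ y = 3 * (k' : ℂ) * (plusPeriod f : ℂ) := hk'
    rw [hx₀tr', hk''] at hky
    have hkk : (k : ℂ) = 3 * (k' : ℂ) := mul_right_cancel₀ hΩC hky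
    have hkz : (k : ℤ) = 3 * k' := by exact_mod_cast hkk
    exact hk3 (Int.natCast_dvd_natCast.mp ⟨k', hkz⟩)
  obtain ⟨g, hg, j, hj3, hgj⟩ := hgen
  obtain ⟨ℓ, b, bp, bm, hℓp, hℓ3, hℓtN, hℓl, hℓb, hbp, hbm, rfl⟩ := hg
  haveI : NeZero ℓ := ⟨hℓp.ne_zero⟩
  haveI : Fact ℓ.Prime := ⟨hℓp⟩
  have hℓN : ¬ ℓ ∣ N := fun h => hℓtN (Dvd.dvd.mul_left h t)
  have hℓt : ¬ ℓ ∣ t := fun h => hℓtN (Dvd.dvd.mul_right h N)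
  have h3ℓ : ¬ (3 : ℤ) ∣ (ℓ : ℤ) - 1 := by omega
  have h3tot : ¬ (3 : ℤ) ∣ (ℓ.totient : ℤ) := by
    rw [Nat.totient_prime hℓp, Nat.cast_sub hℓp.one_lt.le]; push_cast; exact h3ℓ
  have hcop : ℓ.Coprime (3 * N) := by
    rw [Nat.Prime.coprime_iff_not_dvd hℓp]
    intro hd'
    rcases (Nat.Prime.dvd_mul hℓp).mp hd' with h | h
    · have : ℓ = 3 := (Nat.prime_dvd_prime_iff_eq hℓp Nat.prime_three).mp h
      omega
    · exact hℓN h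
  -- the units `u = b̄`, `lam = l̄`, `t̄`
  set u : ZMod ℓ := ((b : ℕ) : ZMod ℓ) with hudef
  set lam : ZMod ℓ := ((l : ℕ) : ZMod ℓ) with hlamdef
  have hu : IsUnit u := (ZMod.isUnit_iff_coprime b ℓ).mpr ((Nat.Prime.coprime_iff_not_dvd hℓp).mpr hℓb).symm
  have hu0 : u ≠ 0 := hu.ne_zero
  have hut : IsUnit ((t : ℕ) : ZMod ℓ) :=
    (ZMod.isUnit_iff_coprime t ℓ).mpr ((Nat.Prime.coprime_iff_not_dvd hℓp).mpr hℓt).symm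
  have ht0 : ((t : ℕ) : ZMod ℓ) ≠ 0 := hut.ne_zero
  have hlam : IsUnit lam :=
    (ZMod.isUnit_iff_coprime l ℓ).mpr ((Nat.Prime.coprime_iff_not_dvd hℓp).mpr hℓl).symm
  have hlam0 : lam ≠ 0 := hlam.ne_zero
  have hu'0 : (t : ZMod ℓ) * u ≠ 0 := mul_ne_zero ht0 hu0
  have hbp' : ((bp : ℕ) : ZMod ℓ) = u * lam := hbp
  have hbm' : ((bm : ℕ) : ZMod ℓ) = u * lam⁻¹ := by
    rw [← hbm, mul_inv_cancel_right₀ hlam0]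
  -- the class `P` and the combination `c`
  set P : DirichletCharacter ℂ ℓ → Prop := fun χ => χ.Even ∧ χ (t : ZMod ℓ) ≠ 1 with hPdef
  set c : DirichletCharacter ℂ ℓ → ℂ :=
    fun χ => χ ((t : ZMod ℓ) * u)⁻¹ + χ (-((t : ZMod ℓ) * u))⁻¹ - χ u⁻¹ - χ (-u)⁻¹ with hcdef
  have hcI : ∀ χ, P χ → IsIntegral ℤ (c χ) := by
    intro χ _
    simp only [hcdef]
    exact ((isIntegral_apply χ _).add (isIntegral_apply χ _)).sub (isIntegral_apply χ _)
      |>.sub (isIntegral_apply χ _)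
  have hc0 : ∀ χ, ¬ P χ → c χ = 0 := by
    intro χ hP
    by_cases hev : χ.Even
    · have h1 : χ (t : ZMod ℓ) = 1 := by
        by_contra h; exact hP ⟨hev, h⟩
      have h1' : χ (t : ZMod ℓ)⁻¹ = 1 := by
        have h := map_mul χ ((t : ZMod ℓ)⁻¹) (t : ZMod ℓ)
        rw [inv_mul_cancel₀ ht0, map_one, h1, mul_one] at h
        exact h.symm
      simp only [hcdef]
      rw [show -((t : ZMod ℓ) * u) = (t : ZMod ℓ) * (-u) by ring, mul_inv, mul_inv, map_mul, map_mul,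
        h1', one_mul, one_mul]
      ring
    · have hodd : χ (-1) = -1 := apply_neg_one_eq_neg_one_of_not_even hev
      simp only [hcdef]
      rw [← neg_inv, ← neg_inv, neg_eq_neg_one_mul (((t : ZMod ℓ) * u)⁻¹), neg_eq_neg_one_mul (u⁻¹),
        map_mul, map_mul, hodd]
      ring
  -- ORTHOGONALITY with the Euler factor at the four points
  have hE : (ℓ.totient : ℂ) * ((j : ℂ) * (plusPeriod f : ℂ))
      = ∑ χ : DirichletCharacter ℂ ℓ, c χ * (eulerFactorTwist l a χ * twistedSymbolSum f χ) := by
    have e1 := sum_char_inv_mul_euler_twistedSymbolSum f l a (x := (t : ZMod ℓ) * u)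
      (y := (t : ZMod ℓ) * (u * lam⁻¹)) (z := (t : ZMod ℓ) * (u * lam)) hu'0 hlam0 (by ring) (by ring)
    have e2 := sum_char_inv_mul_euler_twistedSymbolSum f l a (x := -((t : ZMod ℓ) * u))
      (y := -((t : ZMod ℓ) * (u * lam⁻¹))) (z := -((t : ZMod ℓ) * (u * lam))) (neg_ne_zero.mpr hu'0) hlam0
      (by ring) (by ring)
    have e3 := sum_char_inv_mul_euler_twistedSymbolSum f l a (x := u) (y := u * lam⁻¹) (z := u * lam)
      hu0 hlam0 rfl rfl
    have e4 := sum_char_inv_mul_euler_twistedSymbolSum f l a (x := -u) (y := -(u * lam⁻¹))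
      (z := -(u * lam)) (neg_ne_zero.mpr hu0) hlam0 (by ring) (by ring)
    have g0 := degLoop_add_conj f hreal t b (x := u) hudef.symm
    have gp := degLoop_add_conj f hreal t bp (x := u * lam) hbp'
    have gm := degLoop_add_conj f hreal t bm (x := u * lam⁻¹) hbm'
    have hL : (((l : ℤ) ^ 2 + a ^ 2 : ℤ) : ℂ) * degLoop f t ℓ b
          - ((a * l : ℤ) : ℂ) * (degLoop f t ℓ bm + degLoop f t ℓ bp)
        + conj ((((l : ℤ) ^ 2 + a ^ 2 : ℤ) : ℂ) * degLoop f t ℓ b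
          - ((a * l : ℤ) : ℂ) * (degLoop f t ℓ bm + degLoop f t ℓ bp))
        = (((l : ℤ) ^ 2 + a ^ 2 : ℤ) : ℂ) * (degLoop f t ℓ b + conj (degLoop f t ℓ b))
          - ((a * l : ℤ) : ℂ) * ((degLoop f t ℓ bm + conj (degLoop f t ℓ bm))
              + (degLoop f t ℓ bp + conj (degLoop f t ℓ bp))) := by
      simp only [map_sub, map_mul, map_add, map_intCast]
      ring
    rw [← hgj, hL, g0, gp, gm]
    simp only [hcdef]
    simp_rw [sub_mul, add_mul, Finset.sum_sub_distrib, Finset.sum_add_distrib]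
    rw [e1, e2, e3, e4]
    ring
  obtain ⟨χ, ⟨hev, hχt⟩, hunit⟩ :=
    exists_unit_of_fourier_family f h3tot hΩC (fun χ => eulerFactorTwist l a χ * twistedSymbolSum f χ)
      P c hcI hc0 hj3 hE
  have hne : χ ≠ 1 := by
    rintro rfl
    exact hχt (MulChar.one_apply hut)
  refine ⟨ℓ, inferInstance, hℓp, hℓ3, hℓtN, hℓl, χ,
    eulerFactorTwist l a χ * twistedSymbolSum f χ / (plusPeriod f : ℂ), hcop,
    isPrimitive_of_ne_one_prime hℓp hne, hne, ?_, hχt, hev, by field_simp, hunit⟩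
  intro h3
  apply h3tot
  have := Int.natCast_dvd_natCast.mpr (h3.trans (orderOf_dvd_sub_one_prime hℓp χ))
  rwa [Nat.totient_prime hℓp]

end EulerClassOnePrime

section WLevelEuler

open WeierstrassCurve

/-- **THEOREM U9♮E₁ (W-level, es g22; PROVED).**  For `W` additive at `3` (two binders) at a level with EXACTLY ONE
prime `l ∥ N` (the rest squarefull), the E-translated prime-class ratio-`9` plus hypothesis with `a = a_l(W)` gives
the tree's `ThreeAdicPolarWitness W W D.f` — Euler factor and all (`V = W`, `ρ = 1`). -/
theorem threeAdicPolarWitness_of_degeneracyClassNineEuler (W : WeierstrassCurve ℚ) [W.IsElliptic]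
    {N : ℕ} [NeZero N] (D : ModularParametrizationData W N)
    (h3g : ¬ W.HasGoodReductionAtPrime 3) (h3m : ¬ W.HasMultiplicativeReductionAtPrime 3)
    {l : ℕ} (hone : (N.primeFactors.filter fun q => ¬ q ^ 2 ∣ N) = {l})
    (hd : DegeneracyClassEulerPlusIndexPrimeTo D.f 3 9 l (W.LFunction l)) :
    ThreeAdicPolarWitness W W D.f := by
  obtain ⟨m, hm, hmp, -, -, -, χ, r, hcop, hprim, hne, hord, h9, hev, hr, hu⟩ :=
    exists_prime_eulerUnitTwist_of_degeneracyClass D.f 9 l (W.LFunction l) D.isNewformOf.1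
      D.isNewformOf.coeffField_eq_bot hd
  have h33 : (3 : ZMod m) * 3 = ((9 : ℕ) : ZMod m) := by push_cast; norm_num
  have h9' : χ (3 : ZMod m) * χ (3 : ZMod m) ≠ 1 := by rw [← map_mul, h33]; exact h9
  have h3a : χ (3 : ZMod m) ≠ 1 := fun h => h9' (by rw [h, mul_one])
  have h3b : χ (3 : ZMod m) ≠ -1 := fun h => h9' (by rw [h]; norm_num)
  refine ⟨m, hm, χ, r, 1, D.isNewformOf, h3g, h3m, hcop, hprim, hne, hord, h3a, h3b, hev,
    by push_cast; ring, ?_, ?_⟩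
  · rw [hone, Finset.prod_singleton]
    exact hr
  · intro s hs
    have : (s : ℂ) * r * ((1 : ℚ) : ℂ) / 3 = (s : ℂ) * r / 3 := by push_cast; ring
    rw [this]
    exact hu s hs

/-- **COROLLARY U9♮E₁ (es g22; PROVED, tree lever + tree `KatoFactThreeAt`).**  `3 ∤ c(W)` for every
lattice-optimal modular parametrisation of `W` additive at `3` at a level with exactly one multiplicative prime
`l`, whose newform satisfies the E-translated prime-class ratio-`9` plus hypothesis. -/
theorem not_three_dvd_maninConstant_of_degeneracyClassNineEuler (W : WeierstrassCurve ℚ) [W.IsElliptic]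
    [W.IsGloballyMinimal] {N : ℕ} [NeZero N] (D : ModularParametrizationData W N)
    (hF : KatoFactThreeAt W D.f)
    (hopt : ∀ z ∈ D.L.lattice, ∃ w ∈ periodLattice D.f, z = D.c * w)
    (h3g : ¬ W.HasGoodReductionAtPrime 3) (h3m : ¬ W.HasMultiplicativeReductionAtPrime 3)
    {l : ℕ} (hone : (N.primeFactors.filter fun q => ¬ q ^ 2 ∣ N) = {l})
    (hd : DegeneracyClassEulerPlusIndexPrimeTo D.f 3 9 l (W.LFunction l)) : ¬ (3 : ℤ) ∣ D.c := by
  have hΩ : W.realPeriodRat = ((|D.c| : ℤ) : ℝ) * plusPeriod D.f := by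
    rw [Int.cast_abs]; exact D.realPeriodRat_eq_abs_mul_plusPeriod_of_latticeEq hopt
  have hc0 : D.c ≠ 0 := D.maninConstant_ne_zero_holds
  have hwit : ThreeAdicPolarWitness W W D.f :=
    threeAdicPolarWitness_of_degeneracyClassNineEuler W D h3g h3m hone hd
  have h := not_three_dvd_of_katoFactThreeAt_of_witness W W D.f |D.c| hF hwit hΩ (abs_ne_zero.mpr hc0)
  exact fun h3 => h ((dvd_abs 3 D.c).mpr h3)

/-- **(K₉)♮E₁ ⟹ h66 at one-multiplicative-prime levels (es g22; PROVED).**  E-es-66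
(`ThreeAdicWitnessOfPlusIndexPrimeToThree`) at levels `9 ∣ N` with exactly one `l ∥ N`, additivity of `W` at `3`
as binders, follows from the single f-level law E-es-92. -/
theorem threeAdicPolarWitness_of_eulerLawNine (hlaw : DegeneracyClassEulerLawNine)
    (W : WeierstrassCurve ℚ) [W.IsElliptic] {N : ℕ} [NeZero N] (D : ModularParametrizationData W N)
    (h3g : ¬ W.HasGoodReductionAtPrime 3) (h3m : ¬ W.HasMultiplicativeReductionAtPrime 3)
    (h9 : 3 ^ 2 ∣ N) {l : ℕ} (hone : (N.primeFactors.filter fun q => ¬ q ^ 2 ∣ N) = {l})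
    (hd : PlusIndexPrimeTo 3 D.f) : ThreeAdicPolarWitness W W D.f := by
  have hl : l ∈ N.primeFactors.filter fun q => ¬ q ^ 2 ∣ N := by rw [hone]; exact Finset.mem_singleton_self l
  rw [Finset.mem_filter] at hl
  exact threeAdicPolarWitness_of_degeneracyClassNineEuler W D h3g h3m hone
    (hlaw h9 D.f D.isNewformOf.1 D.isNewformOf.coeffField_eq_bot l hl.1 hl.2 (W.LFunction l)
      (D.isNewformOf.2 l) hd)

/-- **Typer edge (PROVED):** h66 at the `k = 1` levels from E-es-92 WITHOUT additivity binders — `9 ∣ N` makes `W` additive at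
`3` (`additive_of_sq_dvd_level 3`). -/
theorem threeAdicPolarWitness_of_eulerLawNine' (hlaw : DegeneracyClassEulerLawNine)
    (W : WeierstrassCurve ℚ) [W.IsElliptic] {N : ℕ} [NeZero N] (D : ModularParametrizationData W N)
    {l : ℕ} (hone : (N.primeFactors.filter fun q => ¬ q ^ 2 ∣ N) = {l})
    (h9 : 3 ^ 2 ∣ N) (hd : PlusIndexPrimeTo 3 D.f) : ThreeAdicPolarWitness W W D.f := by
  haveI : Fact (Nat.Prime 3) := ⟨Nat.prime_three⟩
  obtain ⟨h3g, h3m⟩ := additive_of_sq_dvd_level 3 W D.f D.isNewformOf h9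
  exact threeAdicPolarWitness_of_eulerLawNine hlaw W D h3g h3m h9 hone hd

end WLevelEuler

end Summit.BirchSwinnertonDyer.Rank1Residual.ManinAdditive.KatoCurve

end
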